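import Literature.NumberTheory.EllipticCurves.TwoIsogenySelmerGroupRankProofs
import Literature.NumberTheory.EllipticCurves.BinaryQuarticGoodReductionSolubilityProofs
import Literature.NumberTheory.DiophantineGeometry.LindMordellQuarticsHassePrincipleFailure
import Literature.NumberTheory.QuadraticForms.PadicSquares
import Mathlib.Tactic.Simproc.Factors
import HarnessLib

/-!
# `17` explicit everywhere-locally-soluble classes of the `2`-isogeny Selmer group `S(692, 114240)` of
# `X' : y² = x³ + 692x² + 114240x` — the homogeneous spaces `w² = d u⁴ + 692 u²z² + (114240/d) z⁴` without a rational point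
# that carry `Ш(X/ℚ)[φ]` for the rank-`2` curve `X = [0, -346, 0, 1369, 0]` (Silverman, AEC X.4.9, X.6.5)

Topic `NumberTheory/EllipticCurves`. Second of three files (`Curve346RankTwoDescent`, this, `Curve346NontrivialSha`). In the tree's vocabulary
`S'(-346, 1369) = S(692, 114240)`; it has at most `2^{ω(114240)+1} = 64` classes, of which `16` are images of rational
points of `X'` (third file). Here `17` further classes `d ∈ {-1, 2, -2, 3, -3, -5, -6, 7, -7, 10, -10, 14, 15, -15, 17, 21, -30}` are shown
everywhere locally soluble by EXPLICIT LOCAL POINTS: a real point; a `ℚ₂`-point (a value `4^m·c`, `c ≡ 1 (mod 8)`, tree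
`padicInt_isSquare_of_toZModPow_three_eq_one`); `ℚ_q`-points at the odd primes `q ∣ Δ = 2 ^ 18 * 3 * 5 * 7 * 17 * 37 ^ 4` (values `q^{2m}·c`,
`c` a non-zero square mod `q`, tree `exists_sq_eq_intCast`); good reduction elsewhere (tree
`BinaryQuartic.isSoluble_padic_of_not_dvd_disc`, Bhargava–Shankar Prop. 5.13). With the `16` point classes this gives
`33 > 32` members, so `dim₂ S(692, 114240) = 6` (third file): ALL classes are everywhere locally soluble.

Everything is re-verified by the kernel (the local points were found by a plain search). Theorems only.

## References

* [SilvermanAEC2009] J. H. Silverman, *AEC*, 2nd ed.: Prop. X.4.9, proof of Prop. X.6.2(b), Prop. X.6.5(a).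
* [BhargavaShankarAnnals2015] M. Bhargava, A. Shankar, Ann. of Math. 181 (2015), Prop. 5.13.
-/

noncomputable section

open scoped Classical

namespace Literature.NumberTheory.EllipticCurves

namespace Curve346

open Literature.NumberTheory.DiophantineGeometry.LindMordellQuartics (exists_sq_eq_intCast)
open Literature.NumberTheory.QuadraticForms (padicInt_isSquare_of_toZModPow_three_eq_one)

/-! ## Local-point helpers for the quartics `⟨d, 0, 692, 0, e⟩` -/

/-- `Δ(⟨d, 0, 692, 0, e⟩) = 16·de·(692² − 4de)² = 876970609213440` for `de = 114240`. [cite: BhargavaShankarAnnals2015, §1.2 (discriminant formula)] -/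
theorem disc_C (d e : ℤ) (hde : d * e = 114240) : (twoIsogenyQuartic 692 d e).disc = 876970609213440 := by
  simp only [twoIsogenyQuartic, BinaryQuartic.disc]
  linear_combination (256 * ((d * e) ^ 2 + 114240 * (d * e) + 13050777600) - 128 * 478864 * (d * e + 114240) + 16 * 229310730496) * hde

/-- A prime dividing `876970609213440 = 2 ^ 18 * 3 * 5 * 7 * 17 * 37 ^ 4` is one of `[2, 3, 5, 7, 17, 37]` (the primes of bad reduction of the quartics).
[cite: BhargavaShankarAnnals2015, Prop. 5.13 (the primes p ∣ Δ(f))] -/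
theorem prime_dvd_disc_cases {p : ℕ} (hp : p.Prime) (h : (p : ℤ) ∣ 876970609213440) : p = 2 ∨ p = 3 ∨ p = 5 ∨ p = 7 ∨ p = 17 ∨ p = 37 := by
  have h0 : p ∣ 2 ^ 18 * 3 * 5 * 7 * 17 * 37 ^ 4 := by exact_mod_cast h
  rcases (Nat.Prime.dvd_mul hp).mp h0 with h0l | hr
  swap
  · exact Or.inr (Or.inr (Or.inr (Or.inr (Or.inr (((Nat.prime_dvd_prime_iff_eq hp (by norm_num : Nat.Prime 37)).mp (hp.dvd_of_dvd_pow hr)))))))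
  rcases (Nat.Prime.dvd_mul hp).mp h0l with h0ll | hr
  swap
  · exact Or.inr (Or.inr (Or.inr (Or.inr (Or.inl ((Nat.prime_dvd_prime_iff_eq hp (by norm_num : Nat.Prime 17)).mp hr)))))
  rcases (Nat.Prime.dvd_mul hp).mp h0ll with h0lll | hr
  swap
  · exact Or.inr (Or.inr (Or.inr (Or.inl ((Nat.prime_dvd_prime_iff_eq hp (by norm_num : Nat.Prime 7)).mp hr))))
  rcases (Nat.Prime.dvd_mul hp).mp h0lll with h0llll | hr
  swap
  · exact Or.inr (Or.inr (Or.inl ((Nat.prime_dvd_prime_iff_eq hp (by norm_num : Nat.Prime 5)).mp hr)))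
  rcases (Nat.Prime.dvd_mul hp).mp h0llll with h0lllll | hr
  swap
  · exact Or.inr (Or.inl ((Nat.prime_dvd_prime_iff_eq hp (by norm_num : Nat.Prime 3)).mp hr))
  exact Or.inl ((Nat.prime_dvd_prime_iff_eq hp (by norm_num : Nat.Prime 2)).mp (hp.dvd_of_dvd_pow h0lllll))

/-- A prime not dividing `876970609213440` (which `2` and `3` divide) is at least `5`.
[cite: BhargavaShankarAnnals2015, Prop. 5.13 (p ≥ 5 with p ∤ Δ)] -/
theorem five_le_of_not_dvd_disc {p : ℕ} (hp : p.Prime) (h : ¬ (p : ℤ) ∣ 876970609213440) : 5 ≤ p := by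
  by_contra hlt
  push Not at hlt
  interval_cases p
  · exact absurd hp (by decide)
  · exact absurd hp (by decide)
  · exact h (by norm_num)
  · exact h (by norm_num)
  · exact absurd hp (by decide)

/-- A real point from a positive value: `f(u, z) = v > 0` gives `(u, z, √v)`.
[cite: SilvermanAEC2009, Prop. X.6.5(a) (real points of the homogeneous spaces)] -/
theorem isSoluble_real_of_pos {d e u z v : ℤ} (huz : u ≠ 0 ∨ z ≠ 0) (hv : 0 < v)
    (hval : d * u ^ 4 + 692 * u ^ 2 * z ^ 2 + e * z ^ 4 = v) :
    ((twoIsogenyQuartic 692 d e).map (Int.castRingHom ℝ)).IsSoluble := by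
  refine ⟨u, z, Real.sqrt v, ?_, ?_⟩
  · rcases huz with h | h
    · exact Or.inl (by exact_mod_cast h)
    · exact Or.inr (by exact_mod_cast h)
  · rw [eval_map_twoIsogenyQuartic, Real.sq_sqrt (by exact_mod_cast hv.le)]
    simp only [eq_intCast]
    exact_mod_cast hval.symm

/-- A `ℚ_q`-point from a square root in `ℤ_q`: `f(u, z) = c·k²` with `r² = c` gives `(u, z, k r)`.
[cite: SilvermanAEC2009, proof of Prop. X.6.2(b) (local points by lifting square roots)] -/
theorem isSoluble_padic_of_sq {q : ℕ} [Fact q.Prime] {d e u z k c : ℤ} (huz : u ≠ 0 ∨ z ≠ 0)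
    (hval : d * u ^ 4 + 692 * u ^ 2 * z ^ 2 + e * z ^ 4 = c * k ^ 2) {r : ℤ_[q]} (hr : r ^ 2 = c) :
    ((twoIsogenyQuartic 692 d e).map (Int.castRingHom ℚ_[q])).IsSoluble := by
  refine ⟨u, z, (k : ℚ_[q]) * r, ?_, ?_⟩
  · rcases huz with h | h
    · exact Or.inl (by exact_mod_cast h)
    · exact Or.inr (by exact_mod_cast h)
  · have h := congrArg ((↑) : ℤ_[q] → ℚ_[q]) hr
    push_cast at h
    have hv : ((d * u ^ 4 + 692 * u ^ 2 * z ^ 2 + e * z ^ 4 : ℤ) : ℚ_[q]) = ((c * k ^ 2 : ℤ) : ℚ_[q]) := by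
      rw [hval]
    push_cast at hv
    rw [eval_map_twoIsogenyQuartic, mul_pow, h]
    simp only [eq_intCast]
    linear_combination -hv

/-- A `2`-adic unit `≡ 1 (mod 8)` is a square in `ℤ₂`. [cite: SilvermanAEC2009, proof of Prop. X.6.2(b) (Exercise 10.12)] -/
theorem exists_sq_eq_two {c : ℤ} (hc : (c : ZMod (2 ^ 3)) = 1) : ∃ r : ℤ_[2], r ^ 2 = c := by
  have hmod : PadicInt.toZModPow 3 ((c : ℤ) : ℤ_[2]) = 1 := by rw [map_intCast]; exact hc
  obtain ⟨W, hW⟩ := padicInt_isSquare_of_toZModPow_three_eq_one (p := 2) hmod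
  exact ⟨W, by rw [sq, ← hW]⟩

/-- Squarefreeness of a (small) integer from the factorisation of its absolute value. [folklore] -/
private theorem squarefree_int_of_natAbs {d : ℤ} {n : ℕ} (h : d.natAbs = n) (hn : n ≠ 0)
    (hnd : n.primeFactorsList.Nodup) : Squarefree d :=
  Int.squarefree_natAbs.mp (h ▸ (Nat.squarefree_iff_nodup_primeFactorsList hn).mpr hnd)

/-! ## The certificates (first part) -/

/-- **`C_{-1} : w² = -1u⁴ + 692u²z² + (-114240)z⁴` is everywhere locally soluble**: real point `(17, 1)` (value `2227`); `ℚ₂`-point `(10, 1)` (value `16²·(-215)`, `-215 ≡ 1 (mod 8)`); `ℚ_{3}`-point `(1, 1)` (value `1²·(-113549)`, `≡ 1² (mod 3)`); `ℚ_{5}`-point `(1, 0)` (value `1²·(-1)`, `≡ 2² (mod 5)`); `ℚ_{7}`-point `(1, 2)` (value `1²·(-1825073)`, `≡ 3² (mod 7)`); `ℚ_{17}`-point `(1, 0)` (value `1²·(-1)`, `≡ 4² (mod 17)`); `ℚ_{37}`-point `(0, 1)` (value `1²·(-114240)`, `≡ 4² (mod 37)`); good reduction at the other primes.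
[cite: SilvermanAEC2009, Prop. X.6.5(a) (the method: local points by Hensel's lemma)]
[cite: BhargavaShankarAnnals2015, Prop. 5.13 (good reduction implies local solubility)] -/
theorem isLocallySoluble_C_m1 : (twoIsogenyQuartic 692 (-1) (-114240)).IsLocallySoluble := by
  refine ⟨isSoluble_real_of_pos (u := 17) (z := 1) (v := 2227) (Or.inl (by norm_num)) (by norm_num) (by norm_num),
    fun p hp => ?_⟩
  have hP : p.Prime := hp.out
  by_cases hdvd : (p : ℤ) ∣ 876970609213440
  · rcases prime_dvd_disc_cases hP hdvd with rfl | rfl | rfl | rfl | rfl | rfl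
    · obtain ⟨r, hr⟩ := exists_sq_eq_two (c := -215) (by decide)
      exact isSoluble_padic_of_sq (u := 10) (z := 1) (k := 16) (Or.inl (by norm_num)) (by norm_num) hr
    · obtain ⟨r, hr⟩ := exists_sq_eq_intCast (q := 3) (by norm_num) (c := -113549) (w := 1) (by norm_num) (by norm_num)
      exact isSoluble_padic_of_sq (u := 1) (z := 1) (k := 1) (Or.inl (by norm_num)) (by norm_num) hr
    · obtain ⟨r, hr⟩ := exists_sq_eq_intCast (q := 5) (by norm_num) (c := -1) (w := 2) (by norm_num) (by norm_num)
      exact isSoluble_padic_of_sq (u := 1) (z := 0) (k := 1) (Or.inl (by norm_num)) (by norm_num) hr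
    · obtain ⟨r, hr⟩ := exists_sq_eq_intCast (q := 7) (by norm_num) (c := -1825073) (w := 3) (by norm_num) (by norm_num)
      exact isSoluble_padic_of_sq (u := 1) (z := 2) (k := 1) (Or.inl (by norm_num)) (by norm_num) hr
    · obtain ⟨r, hr⟩ := exists_sq_eq_intCast (q := 17) (by norm_num) (c := -1) (w := 4) (by norm_num) (by norm_num)
      exact isSoluble_padic_of_sq (u := 1) (z := 0) (k := 1) (Or.inl (by norm_num)) (by norm_num) hr
    · obtain ⟨r, hr⟩ := exists_sq_eq_intCast (q := 37) (by norm_num) (c := -114240) (w := 4) (by norm_num) (by norm_num)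
      exact isSoluble_padic_of_sq (u := 0) (z := 1) (k := 1) (Or.inr (by norm_num)) (by norm_num) hr
  · exact BinaryQuartic.isSoluble_padic_of_not_dvd_disc (five_le_of_not_dvd_disc hP hdvd) _
      (by rw [disc_C (-1) (-114240) (by norm_num)]; exact hdvd)

/-- **`C_{2} : w² = 2u⁴ + 692u²z² + (57120)z⁴` is everywhere locally soluble**: real point `(0, 1)` (value `57120`); `ℚ₂`-point `(2, 1)` (value `4²·(3745)`, `3745 ≡ 1 (mod 8)`); `ℚ_{3}`-point `(1, 1)` (value `1²·(57814)`, `≡ 1² (mod 3)`); `ℚ_{5}`-point `(1, 1)` (value `1²·(57814)`, `≡ 2² (mod 5)`); `ℚ_{7}`-point `(1, 0)` (value `1²·(2)`, `≡ 3² (mod 7)`); `ℚ_{17}`-point `(1, 0)` (value `1²·(2)`, `≡ 6² (mod 17)`); `ℚ_{37}`-point `(7, 1)` (value `37²·(70)`, `≡ 12² (mod 37)`); good reduction at the other primes.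
[cite: SilvermanAEC2009, Prop. X.6.5(a) (the method: local points by Hensel's lemma)]
[cite: BhargavaShankarAnnals2015, Prop. 5.13 (good reduction implies local solubility)] -/
theorem isLocallySoluble_C_2 : (twoIsogenyQuartic 692 (2) (57120)).IsLocallySoluble := by
  refine ⟨isSoluble_real_of_pos (u := 0) (z := 1) (v := 57120) (Or.inr (by norm_num)) (by norm_num) (by norm_num),
    fun p hp => ?_⟩
  have hP : p.Prime := hp.out
  by_cases hdvd : (p : ℤ) ∣ 876970609213440
  · rcases prime_dvd_disc_cases hP hdvd with rfl | rfl | rfl | rfl | rfl | rfl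
    · obtain ⟨r, hr⟩ := exists_sq_eq_two (c := 3745) (by decide)
      exact isSoluble_padic_of_sq (u := 2) (z := 1) (k := 4) (Or.inl (by norm_num)) (by norm_num) hr
    · obtain ⟨r, hr⟩ := exists_sq_eq_intCast (q := 3) (by norm_num) (c := 57814) (w := 1) (by norm_num) (by norm_num)
      exact isSoluble_padic_of_sq (u := 1) (z := 1) (k := 1) (Or.inl (by norm_num)) (by norm_num) hr
    · obtain ⟨r, hr⟩ := exists_sq_eq_intCast (q := 5) (by norm_num) (c := 57814) (w := 2) (by norm_num) (by norm_num)
      exact isSoluble_padic_of_sq (u := 1) (z := 1) (k := 1) (Or.inl (by norm_num)) (by norm_num) hr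
    · obtain ⟨r, hr⟩ := exists_sq_eq_intCast (q := 7) (by norm_num) (c := 2) (w := 3) (by norm_num) (by norm_num)
      exact isSoluble_padic_of_sq (u := 1) (z := 0) (k := 1) (Or.inl (by norm_num)) (by norm_num) hr
    · obtain ⟨r, hr⟩ := exists_sq_eq_intCast (q := 17) (by norm_num) (c := 2) (w := 6) (by norm_num) (by norm_num)
      exact isSoluble_padic_of_sq (u := 1) (z := 0) (k := 1) (Or.inl (by norm_num)) (by norm_num) hr
    · obtain ⟨r, hr⟩ := exists_sq_eq_intCast (q := 37) (by norm_num) (c := 70) (w := 12) (by norm_num) (by norm_num)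
      exact isSoluble_padic_of_sq (u := 7) (z := 1) (k := 37) (Or.inl (by norm_num)) (by norm_num) hr
  · exact BinaryQuartic.isSoluble_padic_of_not_dvd_disc (five_le_of_not_dvd_disc hP hdvd) _
      (by rw [disc_C (2) (57120) (by norm_num)]; exact hdvd)

/-- **`C_{-2} : w² = -2u⁴ + 692u²z² + (-57120)z⁴` is everywhere locally soluble**: real point `(12, 1)` (value `1056`); `ℚ₂`-point `(2, 1)` (value `4²·(-3399)`, `-3399 ≡ 1 (mod 8)`); `ℚ_{3}`-point `(1, 0)` (value `1²·(-2)`, `≡ 1² (mod 3)`); `ℚ_{5}`-point `(1, 2)` (value `1²·(-911154)`, `≡ 1² (mod 5)`); `ℚ_{7}`-point `(1, 1)` (value `1²·(-56430)`, `≡ 2² (mod 7)`); `ℚ_{17}`-point `(1, 0)` (value `1²·(-2)`, `≡ 7² (mod 17)`); `ℚ_{37}`-point `(5, 1)` (value `37²·(-30)`, `≡ 9² (mod 37)`); good reduction at the other primes.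
[cite: SilvermanAEC2009, Prop. X.6.5(a) (the method: local points by Hensel's lemma)]
[cite: BhargavaShankarAnnals2015, Prop. 5.13 (good reduction implies local solubility)] -/
theorem isLocallySoluble_C_m2 : (twoIsogenyQuartic 692 (-2) (-57120)).IsLocallySoluble := by
  refine ⟨isSoluble_real_of_pos (u := 12) (z := 1) (v := 1056) (Or.inl (by norm_num)) (by norm_num) (by norm_num),
    fun p hp => ?_⟩
  have hP : p.Prime := hp.out
  by_cases hdvd : (p : ℤ) ∣ 876970609213440
  · rcases prime_dvd_disc_cases hP hdvd with rfl | rfl | rfl | rfl | rfl | rfl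
    · obtain ⟨r, hr⟩ := exists_sq_eq_two (c := -3399) (by decide)
      exact isSoluble_padic_of_sq (u := 2) (z := 1) (k := 4) (Or.inl (by norm_num)) (by norm_num) hr
    · obtain ⟨r, hr⟩ := exists_sq_eq_intCast (q := 3) (by norm_num) (c := -2) (w := 1) (by norm_num) (by norm_num)
      exact isSoluble_padic_of_sq (u := 1) (z := 0) (k := 1) (Or.inl (by norm_num)) (by norm_num) hr
    · obtain ⟨r, hr⟩ := exists_sq_eq_intCast (q := 5) (by norm_num) (c := -911154) (w := 1) (by norm_num) (by norm_num)
      exact isSoluble_padic_of_sq (u := 1) (z := 2) (k := 1) (Or.inl (by norm_num)) (by norm_num) hr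
    · obtain ⟨r, hr⟩ := exists_sq_eq_intCast (q := 7) (by norm_num) (c := -56430) (w := 2) (by norm_num) (by norm_num)
      exact isSoluble_padic_of_sq (u := 1) (z := 1) (k := 1) (Or.inl (by norm_num)) (by norm_num) hr
    · obtain ⟨r, hr⟩ := exists_sq_eq_intCast (q := 17) (by norm_num) (c := -2) (w := 7) (by norm_num) (by norm_num)
      exact isSoluble_padic_of_sq (u := 1) (z := 0) (k := 1) (Or.inl (by norm_num)) (by norm_num) hr
    · obtain ⟨r, hr⟩ := exists_sq_eq_intCast (q := 37) (by norm_num) (c := -30) (w := 9) (by norm_num) (by norm_num)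
      exact isSoluble_padic_of_sq (u := 5) (z := 1) (k := 37) (Or.inl (by norm_num)) (by norm_num) hr
  · exact BinaryQuartic.isSoluble_padic_of_not_dvd_disc (five_le_of_not_dvd_disc hP hdvd) _
      (by rw [disc_C (-2) (-57120) (by norm_num)]; exact hdvd)

/-- **`C_{3} : w² = 3u⁴ + 692u²z² + (38080)z⁴` is everywhere locally soluble**: real point `(0, 1)` (value `38080`); `ℚ₂`-point `(2, 3)` (value `8²·(48585)`, `48585 ≡ 1 (mod 8)`); `ℚ_{3}`-point `(0, 1)` (value `1²·(38080)`, `≡ 1² (mod 3)`); `ℚ_{5}`-point `(1, 1)` (value `5²·(1551)`, `≡ 1² (mod 5)`); `ℚ_{7}`-point `(1, 1)` (value `1²·(38775)`, `≡ 3² (mod 7)`); `ℚ_{17}`-point `(1, 1)` (value `1²·(38775)`, `≡ 7² (mod 17)`); `ℚ_{37}`-point `(0, 1)` (value `1²·(38080)`, `≡ 9² (mod 37)`); good reduction at the other primes.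
[cite: SilvermanAEC2009, Prop. X.6.5(a) (the method: local points by Hensel's lemma)]
[cite: BhargavaShankarAnnals2015, Prop. 5.13 (good reduction implies local solubility)] -/
theorem isLocallySoluble_C_3 : (twoIsogenyQuartic 692 (3) (38080)).IsLocallySoluble := by
  refine ⟨isSoluble_real_of_pos (u := 0) (z := 1) (v := 38080) (Or.inr (by norm_num)) (by norm_num) (by norm_num),
    fun p hp => ?_⟩
  have hP : p.Prime := hp.out
  by_cases hdvd : (p : ℤ) ∣ 876970609213440
  · rcases prime_dvd_disc_cases hP hdvd with rfl | rfl | rfl | rfl | rfl | rfl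
    · obtain ⟨r, hr⟩ := exists_sq_eq_two (c := 48585) (by decide)
      exact isSoluble_padic_of_sq (u := 2) (z := 3) (k := 8) (Or.inl (by norm_num)) (by norm_num) hr
    · obtain ⟨r, hr⟩ := exists_sq_eq_intCast (q := 3) (by norm_num) (c := 38080) (w := 1) (by norm_num) (by norm_num)
      exact isSoluble_padic_of_sq (u := 0) (z := 1) (k := 1) (Or.inr (by norm_num)) (by norm_num) hr
    · obtain ⟨r, hr⟩ := exists_sq_eq_intCast (q := 5) (by norm_num) (c := 1551) (w := 1) (by norm_num) (by norm_num)
      exact isSoluble_padic_of_sq (u := 1) (z := 1) (k := 5) (Or.inl (by norm_num)) (by norm_num) hr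
    · obtain ⟨r, hr⟩ := exists_sq_eq_intCast (q := 7) (by norm_num) (c := 38775) (w := 3) (by norm_num) (by norm_num)
      exact isSoluble_padic_of_sq (u := 1) (z := 1) (k := 1) (Or.inl (by norm_num)) (by norm_num) hr
    · obtain ⟨r, hr⟩ := exists_sq_eq_intCast (q := 17) (by norm_num) (c := 38775) (w := 7) (by norm_num) (by norm_num)
      exact isSoluble_padic_of_sq (u := 1) (z := 1) (k := 1) (Or.inl (by norm_num)) (by norm_num) hr
    · obtain ⟨r, hr⟩ := exists_sq_eq_intCast (q := 37) (by norm_num) (c := 38080) (w := 9) (by norm_num) (by norm_num)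
      exact isSoluble_padic_of_sq (u := 0) (z := 1) (k := 1) (Or.inr (by norm_num)) (by norm_num) hr
  · exact BinaryQuartic.isSoluble_padic_of_not_dvd_disc (five_le_of_not_dvd_disc hP hdvd) _
      (by rw [disc_C (3) (38080) (by norm_num)]; exact hdvd)

/-- **`C_{-3} : w² = -3u⁴ + 692u²z² + (-38080)z⁴` is everywhere locally soluble**: real point `(10, 1)` (value `1120`); `ℚ₂`-point `(1, 1)` (value `1²·(-37391)`, `-37391 ≡ 1 (mod 8)`); `ℚ_{3}`-point `(1, 1)` (value `1²·(-37391)`, `≡ 1² (mod 3)`); `ℚ_{5}`-point `(1, 1)` (value `1²·(-37391)`, `≡ 2² (mod 5)`); `ℚ_{7}`-point `(1, 0)` (value `1²·(-3)`, `≡ 2² (mod 7)`); `ℚ_{17}`-point `(1, 1)` (value `1²·(-37391)`, `≡ 3² (mod 17)`); `ℚ_{37}`-point `(0, 1)` (value `1²·(-38080)`, `≡ 17² (mod 37)`); good reduction at the other primes.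
[cite: SilvermanAEC2009, Prop. X.6.5(a) (the method: local points by Hensel's lemma)]
[cite: BhargavaShankarAnnals2015, Prop. 5.13 (good reduction implies local solubility)] -/
theorem isLocallySoluble_C_m3 : (twoIsogenyQuartic 692 (-3) (-38080)).IsLocallySoluble := by
  refine ⟨isSoluble_real_of_pos (u := 10) (z := 1) (v := 1120) (Or.inl (by norm_num)) (by norm_num) (by norm_num),
    fun p hp => ?_⟩
  have hP : p.Prime := hp.out
  by_cases hdvd : (p : ℤ) ∣ 876970609213440
  · rcases prime_dvd_disc_cases hP hdvd with rfl | rfl | rfl | rfl | rfl | rfl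
    · obtain ⟨r, hr⟩ := exists_sq_eq_two (c := -37391) (by decide)
      exact isSoluble_padic_of_sq (u := 1) (z := 1) (k := 1) (Or.inl (by norm_num)) (by norm_num) hr
    · obtain ⟨r, hr⟩ := exists_sq_eq_intCast (q := 3) (by norm_num) (c := -37391) (w := 1) (by norm_num) (by norm_num)
      exact isSoluble_padic_of_sq (u := 1) (z := 1) (k := 1) (Or.inl (by norm_num)) (by norm_num) hr
    · obtain ⟨r, hr⟩ := exists_sq_eq_intCast (q := 5) (by norm_num) (c := -37391) (w := 2) (by norm_num) (by norm_num)
      exact isSoluble_padic_of_sq (u := 1) (z := 1) (k := 1) (Or.inl (by norm_num)) (by norm_num) hr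
    · obtain ⟨r, hr⟩ := exists_sq_eq_intCast (q := 7) (by norm_num) (c := -3) (w := 2) (by norm_num) (by norm_num)
      exact isSoluble_padic_of_sq (u := 1) (z := 0) (k := 1) (Or.inl (by norm_num)) (by norm_num) hr
    · obtain ⟨r, hr⟩ := exists_sq_eq_intCast (q := 17) (by norm_num) (c := -37391) (w := 3) (by norm_num) (by norm_num)
      exact isSoluble_padic_of_sq (u := 1) (z := 1) (k := 1) (Or.inl (by norm_num)) (by norm_num) hr
    · obtain ⟨r, hr⟩ := exists_sq_eq_intCast (q := 37) (by norm_num) (c := -38080) (w := 17) (by norm_num) (by norm_num)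
      exact isSoluble_padic_of_sq (u := 0) (z := 1) (k := 1) (Or.inr (by norm_num)) (by norm_num) hr
  · exact BinaryQuartic.isSoluble_padic_of_not_dvd_disc (five_le_of_not_dvd_disc hP hdvd) _
      (by rw [disc_C (-3) (-38080) (by norm_num)]; exact hdvd)

/-- **`C_{-5} : w² = -5u⁴ + 692u²z² + (-22848)z⁴` is everywhere locally soluble**: real point `(8, 1)` (value `960`); `ℚ₂`-point `(2, 7)` (value `8²·(-855039)`, `-855039 ≡ 1 (mod 8)`); `ℚ_{3}`-point `(1, 0)` (value `1²·(-5)`, `≡ 1² (mod 3)`); `ℚ_{5}`-point `(1, 1)` (value `1²·(-22161)`, `≡ 2² (mod 5)`); `ℚ_{7}`-point `(1, 0)` (value `1²·(-5)`, `≡ 3² (mod 7)`); `ℚ_{17}`-point `(1, 2)` (value `1²·(-362805)`, `≡ 3² (mod 17)`); `ℚ_{37}`-point `(1, 10)` (value `37²·(-166845)`, `≡ 5² (mod 37)`); good reduction at the other primes.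
[cite: SilvermanAEC2009, Prop. X.6.5(a) (the method: local points by Hensel's lemma)]
[cite: BhargavaShankarAnnals2015, Prop. 5.13 (good reduction implies local solubility)] -/
theorem isLocallySoluble_C_m5 : (twoIsogenyQuartic 692 (-5) (-22848)).IsLocallySoluble := by
  refine ⟨isSoluble_real_of_pos (u := 8) (z := 1) (v := 960) (Or.inl (by norm_num)) (by norm_num) (by norm_num),
    fun p hp => ?_⟩
  have hP : p.Prime := hp.out
  by_cases hdvd : (p : ℤ) ∣ 876970609213440
  · rcases prime_dvd_disc_cases hP hdvd with rfl | rfl | rfl | rfl | rfl | rfl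
    · obtain ⟨r, hr⟩ := exists_sq_eq_two (c := -855039) (by decide)
      exact isSoluble_padic_of_sq (u := 2) (z := 7) (k := 8) (Or.inl (by norm_num)) (by norm_num) hr
    · obtain ⟨r, hr⟩ := exists_sq_eq_intCast (q := 3) (by norm_num) (c := -5) (w := 1) (by norm_num) (by norm_num)
      exact isSoluble_padic_of_sq (u := 1) (z := 0) (k := 1) (Or.inl (by norm_num)) (by norm_num) hr
    · obtain ⟨r, hr⟩ := exists_sq_eq_intCast (q := 5) (by norm_num) (c := -22161) (w := 2) (by norm_num) (by norm_num)
      exact isSoluble_padic_of_sq (u := 1) (z := 1) (k := 1) (Or.inl (by norm_num)) (by norm_num) hr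
    · obtain ⟨r, hr⟩ := exists_sq_eq_intCast (q := 7) (by norm_num) (c := -5) (w := 3) (by norm_num) (by norm_num)
      exact isSoluble_padic_of_sq (u := 1) (z := 0) (k := 1) (Or.inl (by norm_num)) (by norm_num) hr
    · obtain ⟨r, hr⟩ := exists_sq_eq_intCast (q := 17) (by norm_num) (c := -362805) (w := 3) (by norm_num) (by norm_num)
      exact isSoluble_padic_of_sq (u := 1) (z := 2) (k := 1) (Or.inl (by norm_num)) (by norm_num) hr
    · obtain ⟨r, hr⟩ := exists_sq_eq_intCast (q := 37) (by norm_num) (c := -166845) (w := 5) (by norm_num) (by norm_num)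
      exact isSoluble_padic_of_sq (u := 1) (z := 10) (k := 37) (Or.inl (by norm_num)) (by norm_num) hr
  · exact BinaryQuartic.isSoluble_padic_of_not_dvd_disc (five_le_of_not_dvd_disc hP hdvd) _
      (by rw [disc_C (-5) (-22848) (by norm_num)]; exact hdvd)

/-- **`C_{-6} : w² = -6u⁴ + 692u²z² + (-19040)z⁴` is everywhere locally soluble**: real point `(7, 1)` (value `462`); `ℚ₂`-point `(2, 1)` (value `4²·(-1023)`, `-1023 ≡ 1 (mod 8)`); `ℚ_{3}`-point `(0, 1)` (value `1²·(-19040)`, `≡ 1² (mod 3)`); `ℚ_{5}`-point `(1, 0)` (value `1²·(-6)`, `≡ 2² (mod 5)`); `ℚ_{7}`-point `(1, 0)` (value `1²·(-6)`, `≡ 1² (mod 7)`); `ℚ_{17}`-point `(1, 2)` (value `1²·(-301878)`, `≡ 5² (mod 17)`); `ℚ_{37}`-point `(1, 3)` (value `37²·(-1122)`, `≡ 5² (mod 37)`); good reduction at the other primes.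
[cite: SilvermanAEC2009, Prop. X.6.5(a) (the method: local points by Hensel's lemma)]
[cite: BhargavaShankarAnnals2015, Prop. 5.13 (good reduction implies local solubility)] -/
theorem isLocallySoluble_C_m6 : (twoIsogenyQuartic 692 (-6) (-19040)).IsLocallySoluble := by
  refine ⟨isSoluble_real_of_pos (u := 7) (z := 1) (v := 462) (Or.inl (by norm_num)) (by norm_num) (by norm_num),
    fun p hp => ?_⟩
  have hP : p.Prime := hp.out
  by_cases hdvd : (p : ℤ) ∣ 876970609213440
  · rcases prime_dvd_disc_cases hP hdvd with rfl | rfl | rfl | rfl | rfl | rfl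
    · obtain ⟨r, hr⟩ := exists_sq_eq_two (c := -1023) (by decide)
      exact isSoluble_padic_of_sq (u := 2) (z := 1) (k := 4) (Or.inl (by norm_num)) (by norm_num) hr
    · obtain ⟨r, hr⟩ := exists_sq_eq_intCast (q := 3) (by norm_num) (c := -19040) (w := 1) (by norm_num) (by norm_num)
      exact isSoluble_padic_of_sq (u := 0) (z := 1) (k := 1) (Or.inr (by norm_num)) (by norm_num) hr
    · obtain ⟨r, hr⟩ := exists_sq_eq_intCast (q := 5) (by norm_num) (c := -6) (w := 2) (by norm_num) (by norm_num)
      exact isSoluble_padic_of_sq (u := 1) (z := 0) (k := 1) (Or.inl (by norm_num)) (by norm_num) hr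
    · obtain ⟨r, hr⟩ := exists_sq_eq_intCast (q := 7) (by norm_num) (c := -6) (w := 1) (by norm_num) (by norm_num)
      exact isSoluble_padic_of_sq (u := 1) (z := 0) (k := 1) (Or.inl (by norm_num)) (by norm_num) hr
    · obtain ⟨r, hr⟩ := exists_sq_eq_intCast (q := 17) (by norm_num) (c := -301878) (w := 5) (by norm_num) (by norm_num)
      exact isSoluble_padic_of_sq (u := 1) (z := 2) (k := 1) (Or.inl (by norm_num)) (by norm_num) hr
    · obtain ⟨r, hr⟩ := exists_sq_eq_intCast (q := 37) (by norm_num) (c := -1122) (w := 5) (by norm_num) (by norm_num)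
      exact isSoluble_padic_of_sq (u := 1) (z := 3) (k := 37) (Or.inl (by norm_num)) (by norm_num) hr
  · exact BinaryQuartic.isSoluble_padic_of_not_dvd_disc (five_le_of_not_dvd_disc hP hdvd) _
      (by rw [disc_C (-6) (-19040) (by norm_num)]; exact hdvd)

/-- **`C_{7} : w² = 7u⁴ + 692u²z² + (16320)z⁴` is everywhere locally soluble**: real point `(0, 1)` (value `16320`); `ℚ₂`-point `(4, 5)` (value `32²·(10233)`, `10233 ≡ 1 (mod 8)`); `ℚ_{3}`-point `(1, 0)` (value `1²·(7)`, `≡ 1² (mod 3)`); `ℚ_{5}`-point `(1, 1)` (value `1²·(17019)`, `≡ 2² (mod 5)`); `ℚ_{7}`-point `(1, 1)` (value `1²·(17019)`, `≡ 3² (mod 7)`); `ℚ_{17}`-point `(1, 1)` (value `1²·(17019)`, `≡ 6² (mod 17)`); `ℚ_{37}`-point `(0, 1)` (value `1²·(16320)`, `≡ 15² (mod 37)`); good reduction at the other primes.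
[cite: SilvermanAEC2009, Prop. X.6.5(a) (the method: local points by Hensel's lemma)]
[cite: BhargavaShankarAnnals2015, Prop. 5.13 (good reduction implies local solubility)] -/
theorem isLocallySoluble_C_7 : (twoIsogenyQuartic 692 (7) (16320)).IsLocallySoluble := by
  refine ⟨isSoluble_real_of_pos (u := 0) (z := 1) (v := 16320) (Or.inr (by norm_num)) (by norm_num) (by norm_num),
    fun p hp => ?_⟩
  have hP : p.Prime := hp.out
  by_cases hdvd : (p : ℤ) ∣ 876970609213440
  · rcases prime_dvd_disc_cases hP hdvd with rfl | rfl | rfl | rfl | rfl | rfl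
    · obtain ⟨r, hr⟩ := exists_sq_eq_two (c := 10233) (by decide)
      exact isSoluble_padic_of_sq (u := 4) (z := 5) (k := 32) (Or.inl (by norm_num)) (by norm_num) hr
    · obtain ⟨r, hr⟩ := exists_sq_eq_intCast (q := 3) (by norm_num) (c := 7) (w := 1) (by norm_num) (by norm_num)
      exact isSoluble_padic_of_sq (u := 1) (z := 0) (k := 1) (Or.inl (by norm_num)) (by norm_num) hr
    · obtain ⟨r, hr⟩ := exists_sq_eq_intCast (q := 5) (by norm_num) (c := 17019) (w := 2) (by norm_num) (by norm_num)
      exact isSoluble_padic_of_sq (u := 1) (z := 1) (k := 1) (Or.inl (by norm_num)) (by norm_num) hr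
    · obtain ⟨r, hr⟩ := exists_sq_eq_intCast (q := 7) (by norm_num) (c := 17019) (w := 3) (by norm_num) (by norm_num)
      exact isSoluble_padic_of_sq (u := 1) (z := 1) (k := 1) (Or.inl (by norm_num)) (by norm_num) hr
    · obtain ⟨r, hr⟩ := exists_sq_eq_intCast (q := 17) (by norm_num) (c := 17019) (w := 6) (by norm_num) (by norm_num)
      exact isSoluble_padic_of_sq (u := 1) (z := 1) (k := 1) (Or.inl (by norm_num)) (by norm_num) hr
    · obtain ⟨r, hr⟩ := exists_sq_eq_intCast (q := 37) (by norm_num) (c := 16320) (w := 15) (by norm_num) (by norm_num)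
      exact isSoluble_padic_of_sq (u := 0) (z := 1) (k := 1) (Or.inr (by norm_num)) (by norm_num) hr
  · exact BinaryQuartic.isSoluble_padic_of_not_dvd_disc (five_le_of_not_dvd_disc hP hdvd) _
      (by rw [disc_C (7) (16320) (by norm_num)]; exact hdvd)

/-- **`C_{-7} : w² = -7u⁴ + 692u²z² + (-16320)z⁴` is everywhere locally soluble**: real point `(7, 1)` (value `781`); `ℚ₂`-point `(0, 1)` (value `8²·(-255)`, `-255 ≡ 1 (mod 8)`); `ℚ_{3}`-point `(1, 1)` (value `1²·(-15635)`, `≡ 1² (mod 3)`); `ℚ_{5}`-point `(1, 2)` (value `1²·(-258359)`, `≡ 1² (mod 5)`); `ℚ_{7}`-point `(0, 1)` (value `1²·(-16320)`, `≡ 2² (mod 7)`); `ℚ_{17}`-point `(2, 1)` (value `1²·(-13664)`, `≡ 2² (mod 17)`); `ℚ_{37}`-point `(0, 1)` (value `1²·(-16320)`, `≡ 16² (mod 37)`); good reduction at the other primes.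
[cite: SilvermanAEC2009, Prop. X.6.5(a) (the method: local points by Hensel's lemma)]
[cite: BhargavaShankarAnnals2015, Prop. 5.13 (good reduction implies local solubility)] -/
theorem isLocallySoluble_C_m7 : (twoIsogenyQuartic 692 (-7) (-16320)).IsLocallySoluble := by
  refine ⟨isSoluble_real_of_pos (u := 7) (z := 1) (v := 781) (Or.inl (by norm_num)) (by norm_num) (by norm_num),
    fun p hp => ?_⟩
  have hP : p.Prime := hp.out
  by_cases hdvd : (p : ℤ) ∣ 876970609213440
  · rcases prime_dvd_disc_cases hP hdvd with rfl | rfl | rfl | rfl | rfl | rfl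
    · obtain ⟨r, hr⟩ := exists_sq_eq_two (c := -255) (by decide)
      exact isSoluble_padic_of_sq (u := 0) (z := 1) (k := 8) (Or.inr (by norm_num)) (by norm_num) hr
    · obtain ⟨r, hr⟩ := exists_sq_eq_intCast (q := 3) (by norm_num) (c := -15635) (w := 1) (by norm_num) (by norm_num)
      exact isSoluble_padic_of_sq (u := 1) (z := 1) (k := 1) (Or.inl (by norm_num)) (by norm_num) hr
    · obtain ⟨r, hr⟩ := exists_sq_eq_intCast (q := 5) (by norm_num) (c := -258359) (w := 1) (by norm_num) (by norm_num)
      exact isSoluble_padic_of_sq (u := 1) (z := 2) (k := 1) (Or.inl (by norm_num)) (by norm_num) hr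
    · obtain ⟨r, hr⟩ := exists_sq_eq_intCast (q := 7) (by norm_num) (c := -16320) (w := 2) (by norm_num) (by norm_num)
      exact isSoluble_padic_of_sq (u := 0) (z := 1) (k := 1) (Or.inr (by norm_num)) (by norm_num) hr
    · obtain ⟨r, hr⟩ := exists_sq_eq_intCast (q := 17) (by norm_num) (c := -13664) (w := 2) (by norm_num) (by norm_num)
      exact isSoluble_padic_of_sq (u := 2) (z := 1) (k := 1) (Or.inl (by norm_num)) (by norm_num) hr
    · obtain ⟨r, hr⟩ := exists_sq_eq_intCast (q := 37) (by norm_num) (c := -16320) (w := 16) (by norm_num) (by norm_num)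
      exact isSoluble_padic_of_sq (u := 0) (z := 1) (k := 1) (Or.inr (by norm_num)) (by norm_num) hr
  · exact BinaryQuartic.isSoluble_padic_of_not_dvd_disc (five_le_of_not_dvd_disc hP hdvd) _
      (by rw [disc_C (-7) (-16320) (by norm_num)]; exact hdvd)

/-- `-1 ∈ S(692, 114240)`. [cite: SilvermanAEC2009, Prop. X.4.9] -/
theorem mem_S_m1 : (-1 : ℤ) ∈ twoIsogenySelmerGroup 692 114240 :=
  (mem_twoIsogenySelmerGroup_iff (by norm_num)).mpr
    ⟨squarefree_int_of_natAbs (n := 1) rfl (by norm_num) (by simp), by norm_num,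
      by rw [show (114240 : ℤ) / -1 = -114240 by norm_num]; exact isLocallySoluble_C_m1⟩

/-- `2 ∈ S(692, 114240)`. [cite: SilvermanAEC2009, Prop. X.4.9] -/
theorem mem_S_2 : (2 : ℤ) ∈ twoIsogenySelmerGroup 692 114240 :=
  (mem_twoIsogenySelmerGroup_iff (by norm_num)).mpr
    ⟨squarefree_int_of_natAbs (n := 2) rfl (by norm_num) (by simp), by norm_num,
      by rw [show (114240 : ℤ) / 2 = 57120 by norm_num]; exact isLocallySoluble_C_2⟩

/-- `-2 ∈ S(692, 114240)`. [cite: SilvermanAEC2009, Prop. X.4.9] -/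
theorem mem_S_m2 : (-2 : ℤ) ∈ twoIsogenySelmerGroup 692 114240 :=
  (mem_twoIsogenySelmerGroup_iff (by norm_num)).mpr
    ⟨squarefree_int_of_natAbs (n := 2) rfl (by norm_num) (by simp), by norm_num,
      by rw [show (114240 : ℤ) / -2 = -57120 by norm_num]; exact isLocallySoluble_C_m2⟩

/-- `3 ∈ S(692, 114240)`. [cite: SilvermanAEC2009, Prop. X.4.9] -/
theorem mem_S_3 : (3 : ℤ) ∈ twoIsogenySelmerGroup 692 114240 :=
  (mem_twoIsogenySelmerGroup_iff (by norm_num)).mpr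
    ⟨squarefree_int_of_natAbs (n := 3) rfl (by norm_num) (by simp), by norm_num,
      by rw [show (114240 : ℤ) / 3 = 38080 by norm_num]; exact isLocallySoluble_C_3⟩

/-- `-3 ∈ S(692, 114240)`. [cite: SilvermanAEC2009, Prop. X.4.9] -/
theorem mem_S_m3 : (-3 : ℤ) ∈ twoIsogenySelmerGroup 692 114240 :=
  (mem_twoIsogenySelmerGroup_iff (by norm_num)).mpr
    ⟨squarefree_int_of_natAbs (n := 3) rfl (by norm_num) (by simp), by norm_num,
      by rw [show (114240 : ℤ) / -3 = -38080 by norm_num]; exact isLocallySoluble_C_m3⟩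

/-- `-5 ∈ S(692, 114240)`. [cite: SilvermanAEC2009, Prop. X.4.9] -/
theorem mem_S_m5 : (-5 : ℤ) ∈ twoIsogenySelmerGroup 692 114240 :=
  (mem_twoIsogenySelmerGroup_iff (by norm_num)).mpr
    ⟨squarefree_int_of_natAbs (n := 5) rfl (by norm_num) (by simp), by norm_num,
      by rw [show (114240 : ℤ) / -5 = -22848 by norm_num]; exact isLocallySoluble_C_m5⟩

/-- `-6 ∈ S(692, 114240)`. [cite: SilvermanAEC2009, Prop. X.4.9] -/
theorem mem_S_m6 : (-6 : ℤ) ∈ twoIsogenySelmerGroup 692 114240 :=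
  (mem_twoIsogenySelmerGroup_iff (by norm_num)).mpr
    ⟨squarefree_int_of_natAbs (n := 6) rfl (by norm_num) (by simp), by norm_num,
      by rw [show (114240 : ℤ) / -6 = -19040 by norm_num]; exact isLocallySoluble_C_m6⟩

/-- `7 ∈ S(692, 114240)`. [cite: SilvermanAEC2009, Prop. X.4.9] -/
theorem mem_S_7 : (7 : ℤ) ∈ twoIsogenySelmerGroup 692 114240 :=
  (mem_twoIsogenySelmerGroup_iff (by norm_num)).mpr
    ⟨squarefree_int_of_natAbs (n := 7) rfl (by norm_num) (by simp), by norm_num,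
      by rw [show (114240 : ℤ) / 7 = 16320 by norm_num]; exact isLocallySoluble_C_7⟩

/-- `-7 ∈ S(692, 114240)`. [cite: SilvermanAEC2009, Prop. X.4.9] -/
theorem mem_S_m7 : (-7 : ℤ) ∈ twoIsogenySelmerGroup 692 114240 :=
  (mem_twoIsogenySelmerGroup_iff (by norm_num)).mpr
    ⟨squarefree_int_of_natAbs (n := 7) rfl (by norm_num) (by simp), by norm_num,
      by rw [show (114240 : ℤ) / -7 = -16320 by norm_num]; exact isLocallySoluble_C_m7⟩

end Curve346

end Literature.NumberTheory.EllipticCurves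

end
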